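/- Copyright: the pub-balaban-gaps cell (G2 seat ne6, gen 9; row NE7b) — typist (first refusal, OWNER ruling W-ne7bp1-g104-4) of the
b2b-balaban T⁴-continuum CRUX team's INTERFACE REQUEST NE7b IR-104-2 «THE END AT THE TOWER, ONE STEP DEEPER: EXTRACTION DERIVED FROM
LOCAL CONDITIONAL STABILITY» (OWNER `t4-ne7b-p1` g104, journal l.51203 (b) SPEC ∕ l.51421 RELEASE; refuter design clauses τ-ne7bref-g63-1,
π-ne7bref-g63-4, PRICING-NE7b v64 F353), part 1 of 2: the record.  Released under the licence of the surrounding project. -/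
import Summits.QuantumFields.BalabanUV.T4Continuum.Support.B16HistoryTowerExtractionPricedDataLWR
import Summits.QuantumFields.BalabanUV.T4Continuum.Spine.NE7b.LocalConditionalStability
import Summits.QuantumFields.BalabanUV.T4Continuum.Spine.NE7b.KeyPatternReadingB

/-!
# (α)-INSTANCE — THE END AT THE TOWER, ONE STEP DEEPER, part 1: the record `TowerExtractionStepDataLWR` = END2's
`TowerExtractionPricedDataLWR` (p358420) AT LEVEL MEASURES, with `qA qB extractA extractB` STRUCK and REPLACED by the one-step rows
they are DERIVED from — the step kernel (IR-102-1's `hstep` currency), POINTWISE EXTRACTION + LOCAL CONDITIONAL STABILITY per bad key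
along the key patterns (`…NE7b.LocalConditionalStability`, IR-104-1 `keyPattern`, `KeyPatternReadingB.keyPatternB`) — and the price
sentences booked as WINDOW LEDGERS at the derived quotient `e^{Σ_{j<K}(b − a)}`

Summits-side support leaf of the T⁴-continuum cell (rung (B)+1 on a FINITE torus only; NOT infinite volume, NOT the mass gap, NOT
Clay; NOT a proof of NE7b — the cell's OWN estimate `T4WeightBudget.RelWeightBound`, NOT PRINTED, NOT PROVED).  [folklore] ONE
`structure` (a hypothesis SHAPE: data + located displays + C-side letters, NOTHING of Bałaban's asserted); no `[cite:]` tag, no `Prop`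
minted, zero `sorry`.  INTERFACE REQUEST NE7b IR-104-2 (OWNER `t4-ne7b-p1` g104, SPEC l.51203 (b), RELEASE W-ne7bp1-g104-4 l.51421;
refuter design clauses τ-ne7bref-g63-1 ∕ π-ne7bref-g63-4, PRICING-NE7b v64 F353 ★; typist gaps-ne6 g9, first refusal).  Part 2
(`B16HistoryTowerExtractionEnd3`) DERIVES END2's record (`toPriced`: `extractA ∕ extractB` by `PrefixExtractionLaws.extract_of_prefix_of_subset`
∘ `LocalConditionalStability.hrel_of_LCS` ∘ the readings `KeyPatternReading.fibre_kmemA_subset_badx` ∕ `KeyPatternReadingB.filterB_kmemA_subset_badx`)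
and carries the road `continuumYM4Torus_of_towerExtractionStep_fsc := END2 ∘ toPriced`.  END2's record ∕ road (count DERIVED,
extraction DISPLAYED) stay in the tree as the terminal theorem of record until the OWNER says otherwise.

WHY (OWNER re-cut W-ne7bp1-g103-1∕-2; refuter F338 ★ «LCS-j», F353 ★).  END2 displays, per bad key `k` of the window, `extractA` («the
partial sum of run A's weights over the fibre of `k` is at most `qA K k` times the full sum») with the price sentence `priceA`, and the
run-B twins through `trunc`.  `…NE7b.PrefixExtraction(Laws)` + `…NE7b.LocalConditionalStability` + IR-104-1 PROVE that `extractA`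
FOLLOWS, with `qA K k = e^{Σ_{j<K}(b K k j − a K k j)}`, from the tower's one-step kernel identities and TWO one-step `Prop`s per (cutoff,
key) along the key pattern — `PointwiseExtraction` (print VERBATIM in kind: [Balaban1989LargeFieldII] p. 383 «we estimate the factors by
exp(−p₀(g_j))», PROVED as `chebyshev_extraction`) and `LocCondStability` (THE residual of Bałaban's KIND: the sacrificed part of the
action has conditional moment `≤ e^{b}` in the history term's own state; print's by-value form p. 383 l. 21–28 = `B16Ineq179.Txt383.afield_le`
and p. 380 l. 13–17 «the corresponding constant O(log g_j⁻²)» — `b` INHERITS `log g_j⁻²`, F353; NOT print's statement).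
DESIGN CLAUSES (binding by W-ne7bp1-g104-4).  (1) `(b − a)` is BOOKED OVER THE WINDOW per key (= per history of the key's pattern class:
the exponents are key-level, so gaps-ne6's `sumAlong` is `Σ_{j<K}`): rows `ledgerA ∕ ledgerB` = END2's `priceA ∕ priceB` at `qA K k :=
exp (Σ_{j ∈ range K} (bA K k j − aA K k j))` — NEVER a per-step letter `b ≤ a` (false in regime (P) at free steps, `a = 0 < b`); the
(1.80)-shaped per-component booking closing such a ledger in regime (P) is the SUPPLIER `KeyPatternReadingB.ledger_of_budgets`, not a
row.  (2) print's exponent-condition letters are CARRIED as rows, verbatim from END2: `hexpR` (p. 383 «we assume that 2p₁ − (d+5)r₀ >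
p₀»), `hexpR′ hexpB hexpFL hexpVL`, the gaps `hη … hκᵥ`, `hp₀c`, the tables `hγc hAc hpc hmc`; `ThresholdOK` stays a terminal binder.
(3) NO β-free `b`: `bA ∕ bB` are free letters per (cutoff, key, level), T-extensive and log-inheriting allowed (regime (P): `b =
O(1)M^dR_n^{d+1}d′_n` per live component per step).  π-ne7bref-g63-4: row `hunit` displays the step's characteristic functions as a
DECOMPOSITION OF UNITY over the admissible choices ([Balaban1989LargeFieldI] (1.22)–(1.28)); their positivity, where the instance takes
`a = b = 0, M = 1` at a free step (regime (R), `LocalConditionalStability.unpinned_extraction`), is the instance's to state; signed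
expansion terms read as choices force regime (P).
WHAT.  END2's record FIELD FOR FIELD (same parameter block up to the measures, same order, same binder shapes) with: the MEASURES at
LEVELS (IR-102-1 `B16HistoryTowerEndDressing`: `[∀ K j, MeasurableSpace (X K j)]`, `μ : (K j : ℕ) → Measure (X K j)`, `[∀ K,
IsFiniteMeasure (μ K K)]`; END2's `μ K` reads `μ K K` in `intA H2A shell budget`); STRUCK `qA qB qA_nonneg qB_nonneg extractA extractB
priceA priceB`; ADDED, in IR-102-1's shapes verbatim, the step kernel `χ` with `hstep hunit hint hint′ hintχ`, the truncation's
normalisation `htr0`, and per bad key of the window run A's carriers ∕ exponents ∕ one-step rows `MA aA bA pwA lcsA` (along `keyPattern`,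
cutoff-`K` tower), run B's `MB aB bB pwB lcsB` (along `keyPatternB … trunc K k`, cutoff-`(K+1)` tower), the ledgers `ledgerA ledgerB`; every
other field KEPT VERBATIM (W-ne7bp1-g103-1 §4 (3)(i)).  ROAD-READ by part 2: END2's list plus `hν0 htr0 χ hstep hunit hint hint′ hintχ MA
aA bA pwA lcsA MB aB bB pwB lcsB ledgerA ledgerB`.  HONEST SCOPE: HYPOTHESES over an ABSTRACT tower family; nothing discharged; what the
(A1c) instance OWES of Bałaban's KIND is ONE-STEP-SIZED AND TREE-NAMED — inhabit `LocCondStability` (and the by-definition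
`PointwiseExtraction`) per pinned event of its 𝐑𝐓 tower along the key patterns and book the ledgers (print's (1.79)–(1.80) ∕ Thm 1's
upper half per pinned genealogy — NOT in print: print never pins a genealogy) + the identification; ρ UNVALUED; NEEDS-CONSTANT 0; NE7b
NOT proved; spine 0∕9.  HONEST DEPENDENCY (cell): continuum YM on T⁴ ⇐ BetaPertH ∧ nine spine estimates (0/9 proved); BetaPertH ⇐ (D1)
∧ (D4) ∧ CAP+tail; G-an2-4 gates asym, D1 and NE2/3/4.  Unchanged.
-/
open Finset MeasureTheory
open Literature.MathematicalPhysics.QuantumFieldTheory.Balaban1983to89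
open T4PersistenceDictionary T4PersistentHistoryCount T4BankedInduction T4PrintedShapeBanking
open T4WeightBudget T4GlobalDenominator T4LiveClassFibration T4LiveStructureGas T4LiveGasToTerms T4RecordPriceSeam
open T4PartnerMultiplicity T4IndicatorShell T4MatchingAssembly T4MatchingClosure T4MatchingClosureSocket T4Continuum
open T4StabilitySocket T4BranchingRecordsGas T4TaggedShapeBanking T4CanonicalMenus T4RenewalChains
open Summit.QuantumFields.BalabanUV.T4Continuum.HistoryFlow Summit.QuantumFields.BalabanUV.T4Continuum.HistoryRegeneration
open Summit.QuantumFields.BalabanUV.T4Continuum.HistoryTables Summit.QuantumFields.BalabanUV.T4Continuum.HistoryAssemblyTrees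
open Summit.QuantumFields.BalabanUV.T4Continuum.HistoryAssemblyTerms Summit.QuantumFields.BalabanUV.T4Continuum.HistoryAssemblyPedigree
open Summit.QuantumFields.BalabanUV.T4Continuum.HistoryConstants Summit.QuantumFields.BalabanUV.T4Continuum.HistoryGen
open Literature.MathematicalPhysics.QuantumFieldTheory.Balaban1983to89.B13ScaleTransfer
open Summit.QuantumFields.BalabanUV.T4Continuum.ZoneSkeleton Summit.QuantumFields.BalabanUV.T4Continuum.HistorySocketTH
open Summit.QuantumFields.BalabanUV.T4Continuum.HistoryBankingLE Summit.QuantumFields.BalabanUV.T4Continuum.HistoryExitLE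
open Summit.QuantumFields.BalabanUV.T4Continuum.HistoryAssemblyMult Summit.QuantumFields.BalabanUV.T4Continuum.HistoryAssemblyMultKey
open Summit.QuantumFields.BalabanUV.T4Continuum.HistoryAssemblyRealiseRun Summit.QuantumFields.BalabanUV.T4Continuum.HistoryAssemblyRealiseMult
open Literature.MathematicalPhysics.QuantumFieldTheory.Balaban1983to89.B16SProfile (DropCtl)
open Summit.QuantumFields.BalabanUV.T4Continuum.HistoryGenealogyRealise Summit.QuantumFields.BalabanUV.T4Continuum.HistoryGenealogyInstantiate
open Summit.QuantumFields.BalabanUV.T4Continuum.B16HistoryIndexedRepr Summit.QuantumFields.BalabanUV.T4Continuum.B16HistoryIndexedTrunc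
open Summit.QuantumFields.BalabanUV.T4Continuum.HistoryRealiseCellsRunAssemblyWTVSData Summit.QuantumFields.BalabanUV.T4Continuum.HistoryRealiseCellsRunAssemblyWTVSDataL
open Literature.MathematicalPhysics.QuantumFieldTheory.Balaban1983to89.TreeLength Literature.MathematicalPhysics.QuantumFieldTheory.Balaban1983to89.B16MergeGeometry
open Summit.QuantumFields.BalabanUV.T4Continuum.B16HistoryReprChain Summit.QuantumFields.BalabanUV.T4Continuum.B16HistoryReprInstance
open Summit.QuantumFields.BalabanUV.T4Continuum.B16HistoryReprRead Summit.QuantumFields.BalabanUV.T4Continuum.B16HistoryReprReadCausal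
open Summit.QuantumFields.BalabanUV.T4Continuum.B16HistoryTowerEndDataLWL
open Literature.MathematicalPhysics.QuantumFieldTheory.Balaban1983to89.B16StepFactorsPrinted
open Literature.MathematicalPhysics.QuantumFieldTheory.Balaban1983to89.B16LargeFieldFactors380 (minConst)
open Summit.QuantumFields.BalabanUV.T4Continuum.B16HistoryStepJunction
open Summit.QuantumFields.BalabanUV.T4Continuum.B16HistoryTowerEndPrinted
open Summit.QuantumFields.BalabanUV.T4Continuum.HistoryBankingSharpShares (ell)

open Summit.QuantumFields.BalabanUV.T4Continuum.NE7b.LocalConditionalStability Summit.QuantumFields.BalabanUV.T4Continuum.NE7b.KeyPatternReading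
open Summit.QuantumFields.BalabanUV.T4Continuum.NE7b.KeyPatternReadingB

namespace Summit.QuantumFields.BalabanUV.T4Continuum.B16HistoryTowerExtractionStepDataLWR

noncomputable section

set_option synthInstance.maxSize 1024

/-! ## §1 The record -/

section Data

variable {F : T4Family} {G : Type*} [GaugeGroup G] [MeasurableSpace G] [HaarData G] [RegularGaugeGroup G]

/-- **THE INPUTS OF THE (α) ASSEMBLY AT THE TOWER, ONE STEP DEEPER, BOTH RUNS FROM ONE TOWER FAMILY READ AT PRINT's LIVE INDEX**
(HYPOTHESIS SHAPE — data + located displays + C-side letters, NOTHING of Bałaban's asserted): END2's `TowerExtractionPricedDataLWR` at level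
measures `μ K j` with `qA qB qA_nonneg qB_nonneg extractA extractB priceA priceB` STRUCK and, ADDED, the step kernel rows `χ hstep hunit hint
hint' hintχ` (IR-102-1), the truncation's normalisation `htr0`, per bad key the one-step rows `pwA lcsA` (run A, along `keyPattern`) ∕
`pwB lcsB` (run B = the family at cutoff `K + 1`, along `keyPatternB`) with carriers `MA MB` and key-level exponents `aA bA aB bB`, and the
window ledgers `ledgerA ledgerB`; every other field verbatim. [folklore] -/
structure TowerExtractionStepDataLWR (D : FiniteEpsData F G) (C : T4PrintedShapeBanking.Consts) (O : PrintedO1s) (θv : ℝ)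
    (rr d n : ℕ) (hn : 0 < n) (g₀ : ℕ → ℝ) (os : List (ULoop F))
    (cΛ M Φ β₀ : ℝ) (p₁ η η' κ κ₂ κᵥ : ℕ)
    (P : Type) [DecidableEq P] (X : ℕ → ℕ → Type) (𝒢 : (K j : ℕ) → GoodClass (X K j))
    [∀ K j, MeasurableSpace (X K j)] (μ : (K j : ℕ) → Measure (X K j)) [∀ K, IsFiniteMeasure (μ K K)] where
  /-- the source radius -/
  l₀ : ℝ
  /-- the volume factor of the matching remainders -/
  vol : ℝ
  /-- the source radius is positive -/
  l₀_pos : 0 < l₀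
  /-- the volume factor is positive -/
  vol_pos : 0 < vol
  /-- the threshold in the number of steps -/
  K₀ : ℕ
  /-- THE TOWER of run A: per cutoff `K`, `K` one-step positive operations branching over the choices (IR-97-2), READ AT PRINT's LIVE
  INDEX (C-ρ-TOWER: second-group 𝐑-outputs and healings inside `op j g p`, (1.98) ∕ (1.101)) -/
  T : (K : ℕ) → Tower P (X K) (𝒢 K)
  /-- the small-field choice at every step of every run -/
  p₀ : ℕ → ℕ → P
  /-- the small-field choice lies on every branch -/
  hp₀ : ∀ K j g, p₀ K j ∈ (T K).branch j g
  /-- the dressed initial densities `ρ₀ K t` (H2's `e^{t·obs}·ρ₀`) -/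
  ρ₀ : (K : ℕ) → ℝ → X K 0 → ℝ
  /-- the dressed initial densities are good -/
  hρ₀ : ∀ K t, (𝒢 K 0).Gd (ρ₀ K t)
  /-- the dressed initial densities are non-negative -/
  h0 : ∀ K t x, 0 ≤ ρ₀ K t x
  /-- display (integrability of the elementary terms of the tower's operations, representation letter `1`) -/
  intA : ∀ K t a, ∀ ι ∈ (skelFam T p₀ K).LIdx a,
    Integrable ((reprFam T p₀ ρ₀ hρ₀ h0 (fun _ _ => 1) (fun _ _ => one_pos) K t).eterm a ι) (μ K K)
  /-- display (H2: the dressed push-forward identity, at the tower's final density `densFam`) -/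
  H2A : ∀ K t, |t| ≤ l₀ → K₀ ≤ K →
    ∫ U, Real.exp (t * T4GenFunBounds.prodObs (D.scheme g₀) K os U) * D.dens K (g₀ K) 0 U ∂fieldMeasure (F.P K) 0 G =
      ∫ x, densFam T ρ₀ K t x ∂μ K K
  /-- THE STEP READING of the tower's choices (regions, cubes, classes; flow, memory — IR-99-3) -/
  𝒮 : StepReading P d
  /-- (c1) the reading's blocking parameter is the family's -/
  hL : 𝒮.L = F.L
  /-- (c1) the reading's exponent profile is the run's own -/
  hs : 𝒮.s = runProfile F.L 𝒮.R
  /-- the small-field choice names no region -/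
  hν0 : ∀ K j g, 𝒮.ν K j g (p₀ K j) = ∅
  /-- named regions are pointed, face-connected and of tree length at most their class -/
  hν : ∀ K j g p, ∀ nr ∈ 𝒮.ν K j g p, nr.1 ∈ nr.2 ∧ FaceConnected nr.2 ∧ treeLen nr.2 ≤ 𝒮.κ K nr
  /-- flow: memory domination -/
  hRm : ∀ K s k, 𝒮.Rm K s k ≤ 𝒮.R K s
  /-- flow: memory domination, one-step form -/
  hRmS : ∀ K, K₀ ≤ K → ∀ t k, 𝒮.Rm K t (k + 1) ≤ 𝒮.R K (t + 1)
  /-- flow: non-degenerate memory -/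
  hRm2 : ∀ K, K₀ ≤ K → ∀ t, 2 ≤ 𝒮.Rm K t 1
  /-- PRINT-SIDE STEP DATA: print's constants record ([B16] pp. 380–383's O(1)s, `B16StepFactorsPrinted.Consts`) -/
  c : B16StepFactorsPrinted.Consts
  /-- PRINT-SIDE STEP DATA: print's abstract per-step carriers (J4-a `StepData`) per run `K`, step `j`, prefix `g` -/
  Xs : (K j : ℕ) → (Fin j → P) → StepData d P
  /-- C-side (3R-range): print's p. 380 chain constants are non-negative and within the volume letter's constant -/
  (hC' : 0 ≤ c.C') (hC380 : 0 ≤ c.C380) (hcΛc : c.C' + c.C380 ≤ cΛ)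
  /-- flow (3R-range): `1 ≤ ℓ_{j+1}` on the performed range (couplings at most `e^{-1/2}`) -/
  hℓ1 : ∀ K, K₀ ≤ K → ∀ j, j < K → 1 ≤ ell (gsOf D g₀ K) (j + 1)
  /-- tower-side display (β) (J4.2's `hβ`): PAST THE CUTOFF the step maps kill the unit — the natural padding of a `K`-step run -/
  hβ : ∀ K, K₀ ≤ K → ∀ j, K ≤ j → ∀ (g : Fin j → P) (p : P) (x : X K (j + 1)), ((T K).op j g p).T (fun _ => 1) x = 0
  /-- display: PRINT's PER-STEP SENTENCES `StepDisplaysAt` (IR-100-2, all five conjuncts — the ROUNDED (P) included) AT THE CARRIERS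
  READ OFF THE TOWER AND THE PROCESS (`carriersOf`), every run `K ≥ K₀`, PERFORMED step `j < K`, prefix `g` — J4.2's binder verbatim -/
  hdisp : ∀ K, K₀ ≤ K → ∀ j, j < K → ∀ (g : Fin j → P),
    StepDisplaysAt (runsOf D g₀ K) j (carriersOf T 𝒮 (runsOf D g₀ K) K j g (Xs K j g)) c
  /-- display: the `=` CLASS JUNCTION on the performed range (J4.2's `hclass`) -/
  hclass : ∀ K, K₀ ≤ K → ∀ j, j < K → ∀ (g : Fin j → P) (p : P),
    ∀ x ∈ (𝒮.runPartial K (j + 1) (Fin.snoc g p)).histM.newPairs (j + 1),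
      (Xs K j g).dC p x = (𝒮.κ K ((𝒮.runPartial K (j + 1) (Fin.snoc g p)).histM.newAt (j + 1) x) : ℝ)
  /-- display: p. 380's chain, FIRST LINK — the region volume is at most the large-field volume (3R-range's `hΩ`) -/
  hΩ : ∀ K, K₀ ≤ K → ∀ j, j < K → ∀ (g : Fin j → P) (p : P), (Xs K j g).volZΩ p ≤ (Xs K j g).volZ p
  /-- display: p. 380's chain in CUBE-COUNT form — the large-field volume is at most `(M·R_{j+1})^d` per component cube (3R-range's `hcube`) -/
  hcube : ∀ K, K₀ ≤ K → ∀ j, j < K → ∀ (g : Fin j → P) (p : P),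
    (Xs K j g).volZ p ≤
      (M * 𝒮.R K (j + 1)) ^ d * ∑ cc ∈ (𝒮.runPartial K (j + 1) (Fin.snoc g p)).histM.comp (j + 1), ((cc.2).card : ℝ)
  /-- letter table (3R): print's constants record carries the cell's dimension -/
  hd : c.d = O.d
  /-- letter table (3R, (2.5)): print's size profile AT the run's couplings IS the reading's sizes -/
  hR : ∀ K h, c.R (gsOf D g₀ K h) = (𝒮.R K h : ℝ)
  /-- letter table (3R): print's `p₁`-profile is `ℓ^{p₁}` -/
  hP : ∀ K h, c.P1 (gsOf D g₀ K h) = ell (gsOf D g₀ K) h ^ p₁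
  /-- display (2.5): the reading's sizes are admissible for the running couplings -/
  isRj : ∀ K s, s ≤ K → B14.IsRj F.L rr ((D.C ⟨K, F.m, g₀ K⟩).flow.g s) (𝒮.R K s)
  /-- sizes are at least one -/
  one_le_R : ∀ K, K₀ ≤ K → ∀ t, 1 ≤ 𝒮.R K t
  /-- flow (K): the blocking parameter is at least four -/
  hL4 : 4 ≤ F.L
  /-- flow (K): the run's own exponent profile is non-increasing within the run -/
  hprof : ∀ K, K₀ ≤ K → ∀ t, t < K → runProfile F.L 𝒮.R K (t + 1) ≤ runProfile F.L 𝒮.R K t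
  /-- flow (K): drop control of the run's own profile -/
  hdrop : ∀ K, K₀ ≤ K → ∀ m, DropCtl (runProfile F.L 𝒮.R K) m
  /-- pass-V input condition per term: disjoint new regions -/
  hD : ∀ K, K₀ ≤ K → ∀ τ ∈ HIndex.termSet (skelFam T p₀) K, ((𝒮.reading T p₀).inputOf.run K τ).NewDisjoint
  /-- pass-V input condition per term: every new region lies in the torus' period box at its level -/
  hreg : ∀ K, K₀ ≤ K → ∀ τ ∈ HIndex.termSet (skelFam T p₀) K, ((𝒮.reading T p₀).inputOf.run K τ).RegionsInBox n K
  /-- constants: the window constant -/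
  hn₁ : 13 ≤ C.n₁
  /-- constants -/
  hE₂ : 0 < C.E₂
  /-- constants — `E₃` strictly positive -/
  hE₃pos : 0 < C.E₃
  /-- (2.9)∕(2.7)'s letter `β′` -/
  β' : ℝ
  /-- display (2.9) on the reading's sizes -/
  h29 : ∀ K, K₀ ≤ K → B14FlowStep.FlowIneq29 (𝒮.R K) (D.C ⟨K, F.m, g₀ K⟩).flow.g F.L β' β₀ K
  /-- C-side: print's p. 380 volume constant is nonnegative -/
  hcΛ : 0 ≤ cΛ
  /-- C-side: the cube-side letter `M` of the lattice volume letter is nonnegative -/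
  hMΛ : 0 ≤ M
  /-- flow (ADDED): `0 ≤ ℓ_j = log (g^K_j)⁻²` on every run's performed range (couplings at most one) -/
  hℓ : ∀ K j, j ≤ K → 0 ≤ ell (gsOf D g₀ K) j
  /-- RUN B = THE SAME FAMILY AT CUTOFF `K + 1` (S, NODE O): the truncation of the cutoff-`(K+1)` tower's level-`(K+1)` terms onto
  the cutoff-`K` tower's index -/
  trunc : ℕ → HIndex.Idx (skelFam T p₀) → HIndex.Idx (skelFam T p₀)
  /-- display (S): the truncation maps run B's term set into run A's -/
  htr : ∀ K, K₀ ≤ K → ∀ τ' ∈ HIndex.termSet (skelFam T p₀) (K + 1), trunc K τ' ∈ HIndex.termSet (skelFam T p₀) K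
  /-- display (S) on the truncation (IR-104-2): THE ALL-SMALL TERM TRUNCATES TO THE ALL-SMALL TERM -/
  htr0 : ∀ K, trunc K ⟨K + 1, false, (hsmall (p₀ (K + 1)) (K + 1), (), ())⟩ = ⟨K, false, (hsmall (p₀ K) K, (), ())⟩
  /-- THE STEP KERNEL (IR-102-1's currency): the one-step characteristic functions ∕ transition weights `χ K j g p` of the admissible choice
  `p` after the prefix `g` at level `j` of run `K` ([Balaban1989LargeFieldI] (1.22)–(1.28) pp. 181–183, locator; (A1c)'s to name) -/
  χ : (K j : ℕ) → (Fin j → P) → P → X K j → ℝ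
  /-- display (IR-102-1 `hstep`): the per-(step, choice) integral identity `∫ (op j g p) f dμ_{K,j+1} = ∫ χ_{K,j,g,p}·f dμ_{K,j}` for good `f`
  ([Balaban1989LargeFieldI] (0.3)∕(0.4) p. 176, the 𝐑𝐓 step as an integral operator — locator) -/
  hstep : ∀ K, K₀ ≤ K → ∀ j g p, j < K → g ∈ (T K).adm j → p ∈ (T K).branch j g →
    ∀ f : X K j → ℝ, (𝒢 K j).Gd f → ∫ x, ((T K).op j g p).T f x ∂μ K (j + 1) = ∫ y, χ K j g p y * f y ∂μ K j
  /-- display (IR-102-1 `hunit`; π-ne7bref-g63-4's letter): the step's characteristic functions are a DECOMPOSITION OF UNITY over the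
  admissible choices -/
  hunit : ∀ K, K₀ ≤ K → ∀ j g, j < K → g ∈ (T K).adm j → ∀ y, ∑ p ∈ (T K).branch j g, χ K j g p y = 1
  /-- display: every history term is integrable at its level, on the window -/
  hint : ∀ K t, |t| ≤ l₀ → K₀ ≤ K → ∀ j g, j < K → g ∈ (T K).adm j → Integrable ((T K).eterm (ρ₀ K t) j g) (μ K j)
  /-- display: every one-step image of a history term is integrable -/
  hint' : ∀ K t, |t| ≤ l₀ → K₀ ≤ K → ∀ j g p, j < K → g ∈ (T K).adm j → p ∈ (T K).branch j g →
    Integrable (((T K).op j g p).T ((T K).eterm (ρ₀ K t) j g)) (μ K (j + 1))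
  /-- display: every `χ`-weighted history term is integrable -/
  hintχ : ∀ K t, |t| ≤ l₀ → K₀ ≤ K → ∀ j g p, j < K → g ∈ (T K).adm j → p ∈ (T K).branch j g →
    Integrable (fun y => χ K j g p y * (T K).eterm (ρ₀ K t) j g y) (μ K j)
  /-- run A's MOMENT CARRIERS per (cutoff, key, source, level, prefix): the part of the term's own action sacrificed on the pinned event
  ((A1c): `e^{δQ_{j,Z}}` conditioned through the step kernel — `LocalConditionalStability.PointwiseExtraction`'s docstring) -/
  MA : (K : ℕ) → Finset ((Fin d → ℕ) × Gen PEv × Multiset (PEv × ((Fin d → ℕ) × Finset (Pt d)))) → ℝ → (j : ℕ) → (Fin j → P) →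
    X K j → ℝ
  /-- run A's EXTRACTED EXPONENTS `a` and STABILITY EXPONENTS `b` per (cutoff, key, level) — key-level letters; `b` may inherit `log g_j⁻²`
  (p. 380 l. 13–17; refuter F353), `a = 0 < b` at a free step is allowed (only the window ledger is booked) -/
  (aA bA : ℕ → Finset ((Fin d → ℕ) × Gen PEv × Multiset (PEv × ((Fin d → ℕ) × Finset (Pt d)))) → ℕ → ℝ)
  /-- **POINTWISE EXTRACTION, run A** (`LocalConditionalStability.PointwiseExtraction`; print VERBATIM in kind — [Balaban1989LargeFieldII]
  p. 383 «we estimate the factors by exp(−p₀(g_j))», `chebyshev_extraction`): on the window, for every bad key `k`, along ITS KEY PATTERN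
  (IR-104-1) of the cutoff-`K` tower, the pinned choices' characteristic functions sum to at most `e^{−aA K k j}·MA` pointwise -/
  pwA : ∀ K t, |t| ≤ l₀ → K₀ ≤ K →
    ∀ k ∈ badGMems (memA n F.L (𝒮.reading T p₀)) jhalf (HIndex.termSet (skelFam T p₀))
        (kmemA n F.L hn (lt_of_lt_of_le (by norm_num) (two_le_L F)) (𝒮.reading T p₀)) K,
      PointwiseExtraction (T K)
        (keyPattern T p₀ (kmemA n F.L hn (lt_of_lt_of_le (by norm_num) (two_le_L F)) (𝒮.reading T p₀)) K k) K (χ K) (MA K k t)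
        (fun j _ => aA K k j)
  /-- **LOCAL CONDITIONAL STABILITY, run A** (`LocalConditionalStability.LocCondStability` — THE residual of Bałaban's KIND the (A1c)
  instance OWES: [Balaban1989LargeFieldI] (0.3)–(0.5) p. 176–177, [Balaban1989LargeFieldII] p. 383 l. 21–28 (`B16Ineq179.Txt383.afield_le`)
  and p. 380 l. 13–17, RELATIVISED; NOT print's statement): on the window, for every bad key, along its key pattern, the carrier `MA` times
  the history term is integrable and has conditional expectation at most `e^{bA K k j}` in the term's own state -/
  lcsA : ∀ K t, |t| ≤ l₀ → K₀ ≤ K →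
    ∀ k ∈ badGMems (memA n F.L (𝒮.reading T p₀)) jhalf (HIndex.termSet (skelFam T p₀))
        (kmemA n F.L hn (lt_of_lt_of_le (by norm_num) (two_le_L F)) (𝒮.reading T p₀)) K,
      LocCondStability (T K)
        (keyPattern T p₀ (kmemA n F.L hn (lt_of_lt_of_le (by norm_num) (two_le_L F)) (𝒮.reading T p₀)) K k) K (μ K) (ρ₀ K t)
        (MA K k t) (fun j _ => bA K k j)
  /-- run B's MOMENT CARRIERS (on the cutoff-`(K+1)` tower, at run A's keys) -/
  MB : (K : ℕ) → Finset ((Fin d → ℕ) × Gen PEv × Multiset (PEv × ((Fin d → ℕ) × Finset (Pt d)))) → ℝ → (j : ℕ) → (Fin j → P) →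
    X (K + 1) j → ℝ
  /-- run B's extracted ∕ stability exponents per (cutoff of run A, key, level `j < K + 1`) -/
  (aB bB : ℕ → Finset ((Fin d → ℕ) × Gen PEv × Multiset (PEv × ((Fin d → ℕ) × Finset (Pt d)))) → ℕ → ℝ)
  /-- **POINTWISE EXTRACTION, run B = the family at cutoff `K + 1`**, along RUN B's KEY PATTERN of `k` through `trunc K`
  (`KeyPatternReadingB.keyPatternB`) of the cutoff-`(K+1)` tower -/
  pwB : ∀ K t, |t| ≤ l₀ → K₀ ≤ K →
    ∀ k ∈ badGMems (memA n F.L (𝒮.reading T p₀)) jhalf (HIndex.termSet (skelFam T p₀))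
        (kmemA n F.L hn (lt_of_lt_of_le (by norm_num) (two_le_L F)) (𝒮.reading T p₀)) K,
      PointwiseExtraction (T (K + 1))
        (keyPatternB T p₀ (kmemA n F.L hn (lt_of_lt_of_le (by norm_num) (two_le_L F)) (𝒮.reading T p₀)) trunc K k) (K + 1)
        (χ (K + 1)) (MB K k t) (fun j _ => aB K k j)
  /-- **LOCAL CONDITIONAL STABILITY, run B**, along run B's key pattern of `k`, in the cutoff-`(K+1)` tower's levels `μ (K + 1) j` -/
  lcsB : ∀ K t, |t| ≤ l₀ → K₀ ≤ K →
    ∀ k ∈ badGMems (memA n F.L (𝒮.reading T p₀)) jhalf (HIndex.termSet (skelFam T p₀))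
        (kmemA n F.L hn (lt_of_lt_of_le (by norm_num) (two_le_L F)) (𝒮.reading T p₀)) K,
      LocCondStability (T (K + 1))
        (keyPatternB T p₀ (kmemA n F.L hn (lt_of_lt_of_le (by norm_num) (two_le_L F)) (𝒮.reading T p₀)) trunc K k) (K + 1)
        (μ (K + 1)) (ρ₀ (K + 1) t) (MB K k t) (fun j _ => bB K k j)
  /-- **THE WINDOW LEDGER, run A** (τ-ne7bref-g63-1 (1): `(b − a)` booked over the window per key — per history of the key's pattern
  class —, NEVER per step; = END2's price sentence `priceA` at the DERIVED quotient `qA K k := exp (Σ_{j<K} (bA K k j − aA K k j))`): on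
  the window, for every bad term, `exp (Σ_{j ∈ range K} (bA − aA))` at its key is at most the product over its named members of print's
  shape price at the model's total life cost, discounted by the allowance `exp (−(8∕E₂ · totalCostT + 4 · partnerAges))` — print's KIND:
  [Balaban1989LargeFieldII] (1.79)–(1.80) pp. 383–384 («the factor connected with Z in the form exp(−κ_j(Z) − 2p₀(g_{j(Z)}))») ∕ Thm 1's
  upper half per pinned old genealogy; regime (P)'s supplier `KeyPatternReadingB.ledger_of_budgets`; NOT print's statement -/
  ledgerA : ∀ K t, |t| ≤ l₀ → K₀ ≤ K →
    ∀ τ ∈ badTerms (memA n F.L (𝒮.reading T p₀)) jhalf (HIndex.termSet (skelFam T p₀)) K,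
      Real.exp (∑ j ∈ Finset.range K,
          (bA K (kmemA n F.L hn (lt_of_lt_of_le (by norm_num) (two_le_L F)) (𝒮.reading T p₀) K τ) j -
            aA K (kmemA n F.L hn (lt_of_lt_of_le (by norm_num) (two_le_L F)) (𝒮.reading T p₀) K τ) j)) ≤
        ∏ q ∈ memA n F.L (𝒮.reading T p₀) K τ,
          pshapeTH Prod.fst O C 1 1 (𝒮.R K) (D.C ⟨K, F.m, g₀ K⟩).flow.g 0 (costT Prod.fst C K (𝒮.R K)) q.2 *
            Real.exp (-(8 / C.E₂ * totalCostT Prod.fst C K (𝒮.R K) q.2 + 4 * (partnerAges (PEv.step ∘ Prod.fst) q.2 : ℝ)))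
  /-- **THE WINDOW LEDGER, run B** (= END2's `priceB` at the derived quotient `qB K k := exp (Σ_{j<K+1} (bB K k j − aB K k j))`) -/
  ledgerB : ∀ K t, |t| ≤ l₀ → K₀ ≤ K →
    ∀ τ ∈ badTerms (memA n F.L (𝒮.reading T p₀)) jhalf (HIndex.termSet (skelFam T p₀)) K,
      Real.exp (∑ j ∈ Finset.range (K + 1),
          (bB K (kmemA n F.L hn (lt_of_lt_of_le (by norm_num) (two_le_L F)) (𝒮.reading T p₀) K τ) j -
            aB K (kmemA n F.L hn (lt_of_lt_of_le (by norm_num) (two_le_L F)) (𝒮.reading T p₀) K τ) j)) ≤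
        ∏ q ∈ memA n F.L (𝒮.reading T p₀) K τ,
          pshapeTH Prod.fst O C 1 1 (𝒮.R K) (D.C ⟨K, F.m, g₀ K⟩).flow.g 0 (costT Prod.fst C K (𝒮.R K)) q.2 *
            Real.exp (-(8 / C.E₂ * totalCostT Prod.fst C K (𝒮.R K) q.2 + 4 * (partnerAges (PEv.step ∘ Prod.fst) q.2 : ℝ)))
  /-- NE7c: the two runs' shell parts -/
  (shA shB : ℕ → ℝ → HIndex.Idx (skelFam T p₀) → ℝ)
  /-- NE7c's shell weight budget -/
  Wsh : ℕ → ℝ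
  /-- NE7c (S): the indicator shells' relative weight bound over the tower's terms -/
  shell : ShellWeightBound l₀ (HIndex.termSet (skelFam T p₀))
    (fun _ t => Repr172R.weight (fun K => μ K K) (reprFam T p₀ ρ₀ hρ₀ h0 (fun _ _ => 1) (fun _ _ => one_pos)) t)
    (weightB (fun K => μ K K) (reprFam T p₀ ρ₀ hρ₀ h0 (fun _ _ => 1) (fun _ _ => one_pos)) trunc) shA shB Wsh
  /-- NE7 core budget data -/
  (Cc Rr CcRec RrRec : ℕ → ℝ → HIndex.Idx (skelFam T p₀) → ℝ)
  /-- NE7 core budget rates -/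
  (ν u s₂ q₀ r s : ℕ → ℝ)
  /-- NE7 (S): the re-indexed per-term budget over the tower reading's bad classes -/
  budget : ReindexedBudget l₀ vol (HIndex.termSet (skelFam T p₀))
    (fun K t τ => Repr172R.weight (fun K => μ K K) (reprFam T p₀ ρ₀ hρ₀ h0 (fun _ _ => 1) (fun _ _ => one_pos)) t τ - shA K t τ)
    (fun K t τ => weightB (fun K => μ K K) (reprFam T p₀ ρ₀ hρ₀ h0 (fun _ _ => 1) (fun _ _ => one_pos)) trunc K t τ - shB K t τ)
    (badOfClass (bstrOf Prod.fst (memA n F.L (𝒮.reading T p₀))) (HIndex.termSet (skelFam T p₀))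
      (fun K _ => badClasses Prod.fst (memA n F.L (𝒮.reading T p₀)) jhalf (HIndex.termSet (skelFam T p₀)) K))
    Cc Rr CcRec RrRec ν u s₂ q₀ r s
  /-- summable rates -/
  (sum_r : Summable r) (sum_u : Summable u) (sum_s : Summable s) (sum_s₂ : Summable s₂)
  /-- C-side signs: the volume slack is positive; `β₀, Φ ≥ 0` -/
  (hθv : 0 < θv) (hβ₀ : 0 ≤ β₀) (hΦ : 0 ≤ Φ)
  /-- C-side: the birth-floor mass letter -/
  m : ℝ
  /-- C-side: `A₁² ≤ m` -/
  hm : O.A₁ ^ 2 ≤ m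
  /-- census identity AT PRINT's `t = d+5` ([B16] p. 383 «we assume that 2p₁ − (d+5)r₀ > p₀», the gap named `η`) -/
  hexpR : C.p₀ + rr * (O.d + 5) + η = 2 * p₁
  /-- census identity: `r(q′+1) + r(d+5) + η′ = 2p₁` -/
  hexpR' : rr * (C.q' + 1) + rr * (O.d + 5) + η' = 2 * p₁
  /-- census identity: `r(q′+1) + κ = 2p₀` -/
  hexpB : rr * (C.q' + 1) + κ = 2 * C.p₀
  /-- census identity in LATTICE units: `1 + κ₂ = r·(q′ − d)` -/
  hexpFL : 1 + κ₂ = rr * (C.q' - d)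
  /-- census side condition in LATTICE units: `d ≤ q′` -/
  hdq : d ≤ C.q'
  /-- census identity in LATTICE units: `1 + r·d + κᵥ = 2p₀` -/
  hexpVL : 1 + rr * d + κᵥ = 2 * C.p₀
  /-- exponent gaps -/
  (hη : 1 ≤ η) (hη' : 1 ≤ η') (hκ : 1 ≤ κ) (hκ₂ : 1 ≤ κ₂) (hκᵥ : 1 ≤ κᵥ)
  /-- constants: `1 ≤ p₀` -/
  hp₀c : 1 ≤ C.p₀
  /-- signs of print's O(1)s -/
  (hγ₀ : 0 < O.γ₀) (hA₁ : O.A₁ ≠ 0) (hA₀ : 0 < C.A₀) (hM : 0 < O.M)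
  /-- letter table (part 3 `hsB_of_tables`): print's `γ₀` is the count road's -/
  hγc : c.γ₀ = O.γ₀
  /-- letter table (part 3): print's `A₀` is the count road's -/
  hAc : c.A₀ = C.A₀
  /-- letter table (part 3): print's `p₀` is the count road's -/
  hpc : c.p₀ = C.p₀
  /-- letter table (part 3): the birth-floor mass letter is at most print's p. 381 min-constant `min{½B₃⁻²A₀², 2A₁², A₁²}` -/
  hmc : m ≤ minConst c.B₃ c.A₀ c.A₁
  /-- (2.7)'s power (NE7-rate row) -/
  p27 : ℕ
  /-- (2.7)'s power is at least one -/
  hp27 : 1 ≤ p27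
  /-- display (2.7) per cutoff on the run's couplings -/
  h27 : ∀ K, K₀ ≤ K → B14.FlowIneq27 (D.C ⟨K, F.m, g₀ K⟩).flow.g β' β₀ p27 K


end Data

end

end Summit.QuantumFields.BalabanUV.T4Continuum.B16HistoryTowerExtractionStepDataLWR
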